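import Mathlib
import HarnessLib
import Summits.HubbardSuperconductivity.HubbardSuperconductivity.Theorems.ComplexGFFStiffnessDefs
import Summits.HubbardSuperconductivity.HubbardSuperconductivity.Theorems.ComplexGFFStiffnessHypACumulantPertK

/-!
# Crux `HypALocalTwoPoint`, stub `stub_twoPointGivenZ`: the cosine observable is `K`-uniformly admissible

The sibling crux `HypALocalTwoPoint` (stmt-HubbardSuperconductivity-19155) of the route
`ComplexGFFStiffness` asks for the `N`-uniform AND `K`-uniform bound
`|⟨cos(∂_iφ(x)/√K)⟩_g − ⟨cos(∂_iφ(x)/√K)⟩_0| ≤ C g` (`TwoPointGivenZ`).  In the renormalisation-group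
proof of the line `gnv` the observable enters as a modified single-site factor
`cos(z_i/√K)·(1 + 𝒦(z))` at the site `x`, and the named risk of the stub ("why it might fail") is
whether this factor stays in the weighted `C^{r₀}` class `E_{ζ,𝒬}` UNIFORMLY in `K ≥ 1`.  It does, for
an elementary reason recorded here: every derivative of `z ↦ cos(z_i/√K)` is bounded by
`K^{−j/2} ≤ 1`, so by the Leibniz rule the observable-weighted factor of any `ι`-admissible `𝒦`
(`IsIotaAdmissible r₀ ρ 𝒦`) obeys the admissible bounds with constant `2^{r₀}(1+ρ)`, and it is
`ι`-symmetric because the cosine is real and even.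

* `norm_iteratedFDeriv_cexp_comp_clm_le` — `‖D^j (exp ∘ ℓ)(z)‖ ≤ e^{Re ℓ(z)} ‖ℓ‖^j` for a real-linear
  `ℓ : ℝ⁴ → ℂ`;
* `contDiff_cosObs`, **`norm_iteratedFDeriv_cosObs_le_one`** — `z ↦ cos(z_i/√K)` (as a complex-valued
  function on `ℝ⁴`) is smooth with ALL derivatives of norm `≤ 1`, uniformly in `K ≥ 1`;
* **`isIotaAdmissible_cosObs_mul`** — for `IsIotaAdmissible r₀ ρ 𝒦` and `K ≥ 1`:
  `IsIotaAdmissible r₀ (2^{r₀}(1+ρ)) (z ↦ cos(z_i/√K)(1 + 𝒦(z)))`.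

Helper toward stub `stub_twoPointGivenZ` (it retires the stub's stated `K`-uniformity risk; the
observable flow itself is not here).  Everything is proved; no named fact.

## References
* S. Adams, S. Buchholz, R. Kotecký, S. Müller, arXiv:1910.13564, Sec. 2.1 (the space `E_{ζ,𝒬}`),
  Theorem 2.2 [AdamsBuchholzKoteckyMuller2019].
-/

noncomputable section

-- `Summit.<Summit>.<Problem>`: single-conjunct summit, the duplicate component is mandated (D-0017).
set_option linter.dupNamespace false

namespace Summit.HubbardSuperconductivity.HubbardSuperconductivity.Theorems.ComplexGFF

open scoped BigOperators ComplexConjugate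

/-! ## Exponentials of real-linear phases -/

/-- **`‖D^j (exp ∘ ℓ)(z)‖ ≤ e^{Re ℓ(z)} ‖ℓ‖^j`** for a continuous real-linear `ℓ : ℝ⁴ → ℂ` (chain rule
with a linear map; `‖D^j exp(w)‖ = e^{Re w}`). [cite: AdamsBuchholzKoteckyMuller2019, Sec. 2.1 (the norm ‖·‖_{ζ,𝒬})] -/
theorem norm_iteratedFDeriv_cexp_comp_clm_le (ℓ : (Fin 4 → ℝ) →L[ℝ] ℂ) (j : ℕ) (z : Fin 4 → ℝ) :
    ‖iteratedFDeriv ℝ j (Complex.exp ∘ ℓ) z‖ ≤ Real.exp (ℓ z).re * ‖ℓ‖ ^ j := by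
  rw [ℓ.iteratedFDeriv_comp_right (Complex.contDiff_exp (𝕜 := ℝ) (n := j)) z le_rfl]
  refine (ContinuousMultilinearMap.norm_compContinuousLinearMap_le _ _).trans ?_
  rw [norm_iteratedFDeriv_cexp, Finset.prod_const, Finset.card_univ, Fintype.card_fin]

/-! ## The cosine observable -/

/-- The phase `ℓ_K(z) = i z_i / √K` as a continuous real-linear map `ℝ⁴ → ℂ`, with `‖ℓ_K‖ ≤ 1` for
`K ≥ 1` and `Re ℓ_K(z) = 0`; `cos(z_i/√K) = ½(e^{ℓ_K(z)} + e^{−ℓ_K(z)})`.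
[cite: AdamsBuchholzKoteckyMuller2019, Sec. 2.1] -/
theorem exists_phase_cosObs {κ : ℝ} (hκ : 1 ≤ κ) (i : Fin 4) :
    ∃ ℓ : (Fin 4 → ℝ) →L[ℝ] ℂ, ‖ℓ‖ ≤ 1 ∧ (∀ z, (ℓ z).re = 0) ∧
      (fun z : Fin 4 → ℝ => ((Real.cos (z i / Real.sqrt κ) : ℝ) : ℂ)) =
        (1 / 2 : ℂ) • ((Complex.exp ∘ ℓ) + (Complex.exp ∘ (-ℓ))) := by
  have hκ0 : 0 < Real.sqrt κ := Real.sqrt_pos.2 (by linarith)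
  have hκ1 : 1 ≤ Real.sqrt κ := by rw [← Real.sqrt_one]; exact Real.sqrt_le_sqrt hκ
  let ℓ : (Fin 4 → ℝ) →L[ℝ] ℂ :=
    (Complex.I * (((Real.sqrt κ)⁻¹ : ℝ) : ℂ)) • (Complex.ofRealCLM.comp (ContinuousLinearMap.proj i))
  have hℓ : ∀ z : Fin 4 → ℝ, ℓ z = Complex.I * (((Real.sqrt κ)⁻¹ : ℝ) : ℂ) * ((z i : ℝ) : ℂ) :=
    fun z => rfl
  have hnegℓ : ∀ z : Fin 4 → ℝ, (-ℓ) z = -(ℓ z) := fun z => rfl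
  refine ⟨ℓ, ?_, ?_, ?_⟩
  · refine ContinuousLinearMap.opNorm_le_bound _ zero_le_one fun z => ?_
    rw [hℓ z, one_mul, norm_mul, norm_mul, Complex.norm_I, one_mul, Complex.norm_real, Complex.norm_real,
      Real.norm_eq_abs, abs_of_pos (inv_pos.2 hκ0)]
    have h1 : (Real.sqrt κ)⁻¹ ≤ 1 := inv_le_one_of_one_le₀ hκ1
    have h2 : ‖z i‖ ≤ ‖z‖ := norm_le_pi_norm z i
    calc (Real.sqrt κ)⁻¹ * ‖z i‖ ≤ 1 * ‖z‖ := mul_le_mul h1 h2 (norm_nonneg _) zero_le_one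
      _ = ‖z‖ := one_mul _
  · intro z
    rw [hℓ z]
    simp [Complex.mul_re, Complex.I_re, Complex.I_im]
  · funext z
    simp only [Pi.smul_apply, Pi.add_apply, Function.comp_apply, hnegℓ z, hℓ z, smul_eq_mul]
    rw [Complex.ofReal_cos, Complex.cos]
    have : ((z i / Real.sqrt κ : ℝ) : ℂ) * Complex.I =
        Complex.I * (((Real.sqrt κ)⁻¹ : ℝ) : ℂ) * ((z i : ℝ) : ℂ) := by
      push_cast; ring
    rw [this, neg_mul, this]
    ring

/-- **`z ↦ cos(z_i/√K)` is smooth** (as a complex-valued function on `ℝ⁴`).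
[cite: AdamsBuchholzKoteckyMuller2019, Sec. 2.1] -/
theorem contDiff_cosObs {κ : ℝ} (hκ : 1 ≤ κ) (i : Fin 4) {m : WithTop ℕ∞} :
    ContDiff ℝ m (fun z : Fin 4 → ℝ => ((Real.cos (z i / Real.sqrt κ) : ℝ) : ℂ)) := by
  obtain ⟨ℓ, -, -, heq⟩ := exists_phase_cosObs hκ i
  rw [heq]
  exact ((Complex.contDiff_exp.comp ℓ.contDiff).add (Complex.contDiff_exp.comp (-ℓ).contDiff)).const_smul
    (1 / 2 : ℂ)

/-- **All derivatives of `z ↦ cos(z_i/√K)` have norm `≤ 1`, uniformly in `K ≥ 1`** (each is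
`½(D^j e^{ℓ_K} + D^j e^{−ℓ_K})` with `‖D^j e^{±ℓ_K}(z)‖ ≤ ‖ℓ_K‖^j ≤ 1`).
[cite: AdamsBuchholzKoteckyMuller2019, Sec. 2.1 (the norm ‖·‖_{ζ,𝒬})] -/
theorem norm_iteratedFDeriv_cosObs_le_one {κ : ℝ} (hκ : 1 ≤ κ) (i : Fin 4) (j : ℕ) (z : Fin 4 → ℝ) :
    ‖iteratedFDeriv ℝ j (fun z : Fin 4 → ℝ => ((Real.cos (z i / Real.sqrt κ) : ℝ) : ℂ)) z‖ ≤ 1 := by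
  obtain ⟨ℓ, hℓ, hre, heq⟩ := exists_phase_cosObs hκ i
  rw [heq]
  have h1 : ContDiff ℝ j (Complex.exp ∘ ℓ) := Complex.contDiff_exp.comp ℓ.contDiff
  have h2 : ContDiff ℝ j (Complex.exp ∘ (-ℓ)) := Complex.contDiff_exp.comp (-ℓ).contDiff
  have h12 : ContDiff ℝ j ((Complex.exp ∘ ℓ) + (Complex.exp ∘ (-ℓ))) := h1.add h2
  rw [iteratedFDeriv_const_smul_apply (a := (1 / 2 : ℂ)) h12.contDiffAt,
    iteratedFDeriv_add_apply h1.contDiffAt h2.contDiffAt]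
  have hb : ∀ ℓ' : (Fin 4 → ℝ) →L[ℝ] ℂ, ‖ℓ'‖ ≤ 1 → (ℓ' z).re = 0 →
      ‖iteratedFDeriv ℝ j (Complex.exp ∘ ℓ') z‖ ≤ 1 := by
    intro ℓ' hℓ' hre'
    refine (norm_iteratedFDeriv_cexp_comp_clm_le ℓ' j z).trans ?_
    rw [hre', Real.exp_zero, one_mul]
    exact pow_le_one₀ (norm_nonneg _) hℓ'
  have hb1 := hb ℓ hℓ (hre z)
  have hb2 := hb (-ℓ) (by rwa [norm_neg])
    (by rw [show (-ℓ) z = -(ℓ z) from rfl, Complex.neg_re, hre z, neg_zero])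
  calc ‖(1 / 2 : ℂ) • (iteratedFDeriv ℝ j (Complex.exp ∘ ℓ) z + iteratedFDeriv ℝ j (Complex.exp ∘ (-ℓ)) z)‖
      ≤ ‖(1 / 2 : ℂ)‖ * (‖iteratedFDeriv ℝ j (Complex.exp ∘ ℓ) z‖ + ‖iteratedFDeriv ℝ j (Complex.exp ∘ (-ℓ)) z‖) := by
        rw [norm_smul]; exact mul_le_mul_of_nonneg_left (norm_add_le _ _) (norm_nonneg _)
    _ ≤ (1 / 2 : ℝ) * (1 + 1) := by
        have : ‖(1 / 2 : ℂ)‖ = 1 / 2 := by norm_num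
        rw [this]; exact mul_le_mul_of_nonneg_left (add_le_add hb1 hb2) (by norm_num)
    _ = 1 := by norm_num

/-! ## The observable-weighted site factor is admissible, uniformly in `K ≥ 1` -/

/-- **`K`-uniform admissibility of the observable-weighted perturbation**: if `𝒦` is `ι`-admissible with
`(r₀, ρ)` (`ρ ≥ 0`) and `K ≥ 1`, then `z ↦ cos(z_i/√K)·(1 + 𝒦(z))` is `C^{r₀}`, every derivative of
order `≤ r₀` is bounded by `2^{r₀}(1+ρ)·e^{|z|²/4}` (Leibniz rule with `‖D^j cos(·_i/√K)‖ ≤ 1` and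
`‖D^j(1+𝒦)‖ ≤ (1+ρ)e^{|z|²/4}`), and it is `ι`-symmetric — i.e. `IsIotaAdmissible r₀ (2^{r₀}(1+ρ))`, with
a constant independent of `K`. [cite: AdamsBuchholzKoteckyMuller2019, Sec. 2.1 / Thm 2.2 (ℓ = 1 with an observable)] -/
theorem isIotaAdmissible_cosObs_mul {r₀ : ℕ} {ρ : ℝ} (hρ : 0 ≤ ρ) {𝒦 : (Fin 4 → ℝ) → ℂ}
    (h𝒦 : IsIotaAdmissible r₀ ρ 𝒦) {κ : ℝ} (hκ : 1 ≤ κ) (i : Fin 4) :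
    IsIotaAdmissible r₀ (2 ^ r₀ * (1 + ρ))
      (fun z : Fin 4 → ℝ => ((Real.cos (z i / Real.sqrt κ) : ℝ) : ℂ) * (1 + 𝒦 z)) := by
  obtain ⟨h𝒦d, h𝒦b, h𝒦ι⟩ := h𝒦
  have hcos : ContDiff ℝ r₀ (fun z : Fin 4 → ℝ => ((Real.cos (z i / Real.sqrt κ) : ℝ) : ℂ)) :=
    contDiff_cosObs hκ i
  have hg : ContDiff ℝ r₀ (fun z : Fin 4 → ℝ => 1 + 𝒦 z) := contDiff_const.add h𝒦d
  refine ⟨hcos.mul hg, fun k hk z => ?_, fun z => ?_⟩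
  · set E : ℝ := Real.exp ((∑ i : Fin 4, (z i) ^ 2) / 4) with hE
    have hE1 : 1 ≤ E := Real.one_le_exp (by positivity)
    -- derivatives of `1 + 𝒦`
    have hgb : ∀ j ≤ k, ‖iteratedFDeriv ℝ j (fun z : Fin 4 → ℝ => 1 + 𝒦 z) z‖ ≤ (1 + ρ) * E := by
      intro j hj
      rcases Nat.eq_zero_or_pos j with rfl | hj0
      · rw [norm_iteratedFDeriv_zero]
        have h0 := h𝒦b 0 (Nat.zero_le _) z
        rw [norm_iteratedFDeriv_zero] at h0
        calc ‖1 + 𝒦 z‖ ≤ ‖(1 : ℂ)‖ + ‖𝒦 z‖ := norm_add_le _ _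
          _ ≤ 1 * E + ρ * E := by rw [norm_one]; exact add_le_add (by linarith) h0
          _ = (1 + ρ) * E := by ring
      · have hjr : j ≤ r₀ := hj.trans hk
        have hfun : (fun z : Fin 4 → ℝ => 1 + 𝒦 z) = (fun _ => (1 : ℂ)) + 𝒦 := by funext y; rfl
        rw [hfun, iteratedFDeriv_add_apply contDiff_const.contDiffAt
          ((h𝒦d.of_le (by exact_mod_cast hjr)).contDiffAt), iteratedFDeriv_const_of_ne hj0.ne',
          Pi.zero_apply, zero_add]
        calc ‖iteratedFDeriv ℝ j 𝒦 z‖ ≤ ρ * E := h𝒦b j hjr z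
          _ ≤ (1 + ρ) * E := by nlinarith
    -- Leibniz
    have hL := norm_iteratedFDeriv_mul_le (N := (r₀ : WithTop ℕ∞)) hcos hg z (n := k) (by exact_mod_cast hk)
    refine hL.trans ?_
    calc ∑ j ∈ Finset.range (k + 1), (k.choose j : ℝ) *
          ‖iteratedFDeriv ℝ j (fun z : Fin 4 → ℝ => ((Real.cos (z i / Real.sqrt κ) : ℝ) : ℂ)) z‖ *
          ‖iteratedFDeriv ℝ (k - j) (fun z : Fin 4 → ℝ => 1 + 𝒦 z) z‖
        ≤ ∑ j ∈ Finset.range (k + 1), (k.choose j : ℝ) * 1 * ((1 + ρ) * E) := by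
          refine Finset.sum_le_sum fun j _ => ?_
          have h1 := norm_iteratedFDeriv_cosObs_le_one hκ i j z
          have h2 := hgb (k - j) (Nat.sub_le _ _)
          gcongr
      _ = 2 ^ k * ((1 + ρ) * E) := by
          rw [← Finset.sum_mul, ← Finset.sum_mul]
          congr 1
          rw [mul_one]
          exact_mod_cast Nat.sum_range_choose k
      _ ≤ 2 ^ r₀ * ((1 + ρ) * E) := by
          refine mul_le_mul_of_nonneg_right (pow_le_pow_right₀ (by norm_num) hk) (by positivity)
      _ = 2 ^ r₀ * (1 + ρ) * E := by ring
  · -- `ι`-symmetry: the cosine is real and even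
    have hc : Real.cos ((-z) i / Real.sqrt κ) = Real.cos (z i / Real.sqrt κ) := by
      rw [Pi.neg_apply, neg_div, Real.cos_neg]
    show ((Real.cos ((-z) i / Real.sqrt κ) : ℝ) : ℂ) * (1 + 𝒦 (-z)) =
      conj (((Real.cos (z i / Real.sqrt κ) : ℝ) : ℂ) * (1 + 𝒦 z))
    rw [hc, h𝒦ι z, map_mul, map_add, map_one, Complex.conj_ofReal]

end Summit.HubbardSuperconductivity.HubbardSuperconductivity.Theorems.ComplexGFF

end
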